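import Mathlib
import HarnessLib
import Summits.KontsevichZagierPeriods.Zeta5Search.SorokinHolomorphyH0
import Summits.KontsevichZagierPeriods.Zeta5Search.VWPSeriesHolomorphyH0
import Summits.KontsevichZagierPeriods.Zeta5Search.SorokinConvergenceVWP

/-!
# ζ(5) search — continuation in `h₀` of Zudilin's identity (4): from a sub-ray to the whole admissible half-plane (cell `pub-zeta5`, ct-1 g28)

HONEST FRAMING: systematic search; no irrationality claim unless kernel-certified.  An analytic-continuation step for an identity of
special functions; nothing here is an irrationality result, a worthiness exponent or a denominator statement; no named fact is
discharged; no definition is introduced.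

Brick B6e (continuation part) of `HOME/ct-1/g28/VWP-BLUEPRINT-g28.md` §3 (g) / §5.  With `h_v := Function.update h 0 v` and the typed shapes
`S(n)(g)` (prefactor over `Finset.Icc 1 (n+1)`, series over `Finset.range (n+3)`, `J_n(g₁; g_{j+2} | 1+g₀−g_{j+3})`):

* `eqOn_of_eventually_eq_ofReal` — identity theorem on a preconnected open set from agreement at the real points NEAR one real point;
* `corner_of_vwp` — the corner conditions of `SorokinConvergence.integrableOn_sorokinIntegrand` for the parametrisation (4) from the typed
  hypotheses on a real vector (g27's `chain_lt`, `sum_Icc_odd`);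
* `differentiableAt_rhs` / `differentiableAt_lhs` — both sides of `S(n)(h_v)` are holomorphic in `v` on the admissible half-plane
  (`SorokinHolomorphyH0.differentiableAt_shift`, `VWPSeriesHolomorphyH0.differentiableAt_series_h0` + `prod_update_zero`);
* **`continuation`** — if `S(n)(h_t)` holds for all REAL `t > L'` (`L' ≥ M`), it holds for every complex `v` with `Re v > M`, where `M`
  dominates the lower bounds on `h₀` of the typed hypotheses.

Theorems only; imports `SorokinHolomorphyH0`, `VWPSeriesHolomorphyH0`, `SorokinConvergenceVWP`.
-/

noncomputable section

namespace Summit.KontsevichZagierPeriods.Zeta5Search.VWPContinuationH0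

open MeasureTheory Set Filter
open scoped Topology
open Literature.NumberTheory.Irrationality.Zudilin2002 (nestedQ)
open Summit.KontsevichZagierPeriods.Zeta5Search.SorokinHolomorphyH0 (differentiableAt_shift)
open Summit.KontsevichZagierPeriods.Zeta5Search.VWPSeriesHolomorphyH0 (differentiableAt_series_h0 prod_update_zero)
open Summit.KontsevichZagierPeriods.Zeta5Search.SorokinConvergenceVWP (chain_lt sum_Icc_odd)
open Summit.KontsevichZagierPeriods.Zeta5Search.BarnesMellin (ne_neg_nat_of_re_pos)

/-! ### 1. The identity theorem from a real half-line -/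

/-- **Identity theorem, real points near one real point**: `U` open preconnected, `↑x₀ ∈ U`, `f, g` holomorphic on `U`, and `f t = g t` for
all real `t` in a neighbourhood of `x₀` ⇒ `f = g` on `U` (variant of `Literature.Analysis.Complex.ConeTubeIdentity.eqOn_of_isPreconnected_of_eq_ofReal`). -/
theorem eqOn_of_eventually_eq_ofReal {U : Set ℂ} (hU : IsOpen U) (hUc : IsPreconnected U) {x₀ : ℝ} (hx₀ : (x₀ : ℂ) ∈ U)
    {f g : ℂ → ℂ} (hf : DifferentiableOn ℂ f U) (hg : DifferentiableOn ℂ g U) (h : ∀ᶠ t : ℝ in 𝓝 x₀, f t = g t) : EqOn f g U := by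
  refine (hf.analyticOnNhd hU).eqOn_of_preconnected_of_frequently_eq (hg.analyticOnNhd hU) hUc hx₀ ?_
  have htend : Tendsto (fun t : ℝ => (t : ℂ)) (𝓝[≠] x₀) (𝓝[≠] (x₀ : ℂ)) :=
    Complex.continuous_ofReal.continuousWithinAt.tendsto_nhdsWithin (fun t ht => by simpa using ht)
  exact htend.frequently (h.filter_mono nhdsWithin_le_nhds).frequently

/-! ### 2. Corner conditions for the parametrisation (4) -/

/-- **Corner conditions from the typed hypotheses** (real vector `r`): edges, mixed corners (`chain_lt`) and the deepest corner for odd `k`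
(`sum_Icc_odd`), for `a₀ = r₁`, `a_j = r_{j+2}`, `b_j = 1 + r₀ − r_{j+3}`. -/
theorem corner_of_vwp {k : ℕ} (r : ℕ → ℝ) (h5 : (2 / ((k : ℝ) + 1)) * (∑ j ∈ Finset.Icc 1 (k + 2), r j) < 1 + r 0)
    (h6 : ∀ j ∈ Finset.Icc 2 (k + 1), 0 < r j ∧ r j < 1 + r 0 - r (j + 1)) (h12 : r 1 + r 2 < 1 + r 0) :
    (∀ j, j < k → 0 < r (j + 2) ∧ r (j + 2) < 1 + r 0 - r (j + 3)) ∧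
    (∀ i, 2 * i + 2 ≤ k →
      r 1 < (∑ m ∈ Finset.range (i + 1), ((1 + r 0 - r (2 * m + 3)) - r (2 * m + 2))) + r (2 * i + 1 + 2)) ∧
    (Odd k → r 1 < ∑ m ∈ Finset.range ((k + 1) / 2), ((1 + r 0 - r (2 * m + 3)) - r (2 * m + 2))) := by
  refine ⟨fun j hj => ?_, fun i hi => ?_, fun hodd => ?_⟩
  · have h' := h6 (j + 2) (Finset.mem_Icc.2 ⟨by omega, by omega⟩)
    rw [show j + 2 + 1 = j + 3 by ring] at h'
    exact h'
  · exact chain_lt r h6 h12 i hi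
  · obtain ⟨q, rfl⟩ := hodd
    rw [show (2 * q + 1 + 1) / 2 = q + 1 by omega]
    rw [show 2 * q + 1 + 2 = 2 * q + 3 by ring, sum_Icc_odd r q] at h5
    have hpos : (0 : ℝ) < ((2 * q + 1 : ℕ) : ℝ) + 1 := by positivity
    rw [div_mul_eq_mul_div, div_lt_iff₀ hpos] at h5
    have hcast : (1 + r 0) * (((2 * q + 1 : ℕ) : ℝ) + 1) = 2 * (((q : ℝ) + 1) * (1 + r 0)) := by push_cast; ring
    rw [hcast] at h5
    have hs : ∑ m ∈ Finset.range (q + 1), ((1 + r 0 - r (2 * m + 3)) - r (2 * m + 2)) =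
        ((q : ℝ) + 1) * (1 + r 0) - ∑ m ∈ Finset.range (q + 1), (r (2 * m + 2) + r (2 * m + 3)) := by
      rw [eq_sub_iff_add_eq, ← Finset.sum_add_distrib,
        Finset.sum_congr rfl (fun m _ => (by ring : ((1 + r 0 - r (2 * m + 3)) - r (2 * m + 2)) + (r (2 * m + 2) + r (2 * m + 3)) =
          1 + r 0)), Finset.sum_const, Finset.card_range, nsmul_eq_mul]
      push_cast
      ring
    rw [hs]
    linarith

/-! ### 3. Holomorphy of both sides of `S(n)(h_v)` in `v` -/

/-- **The J-side**: `w ↦ J_n(h₁; h_{j+2} | 1+w−h_{j+3})` is holomorphic at every `v` at which the typed hypotheses hold for the real parts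
(`n ≥ 1`, `Re h₁ ≥ 0`). -/
theorem differentiableAt_rhs {n : ℕ} (hn : 1 ≤ n) (h : ℕ → ℂ) (v : ℂ) (h1 : 0 ≤ (h 1).re)
    (h5 : (2 / ((n : ℝ) + 1)) * (∑ j ∈ Finset.Icc 1 (n + 2), (h j).re) < 1 + v.re)
    (h6 : ∀ j ∈ Finset.Icc 2 (n + 1), 0 < (h j).re ∧ (h j).re < 1 + v.re - (h (j + 1)).re)
    (h12 : (h 1).re + (h 2).re < 1 + v.re) :
    DifferentiableAt ℂ (fun w : ℂ => ∫ x in Set.pi univ (fun _ : Fin n => Icc (0 : ℝ) 1),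
      (∏ j : Fin n, ((x j : ℝ) : ℂ) ^ (h (j + 2) - 1) * (1 - ((x j : ℝ) : ℂ)) ^ ((1 + w - h (j + 3)) - h (j + 2) - 1)) *
        ((nestedQ (List.ofFn x) : ℝ) : ℂ) ^ (-h 1)) v := by
  -- the real vector of (4) at `h₀ = v`
  set r : ℕ → ℝ := fun j => if j = 0 then v.re else (h j).re with hr
  have hr0 : r 0 = v.re := by simp [hr]
  have hrj : ∀ j, j ≠ 0 → r j = (h j).re := fun j hj => by simp [hr, hj]
  have h5' : (2 / ((n : ℝ) + 1)) * (∑ j ∈ Finset.Icc 1 (n + 2), r j) < 1 + r 0 := by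
    rw [hr0, Finset.sum_congr rfl (fun j hj => hrj j (by have := (Finset.mem_Icc.1 hj).1; omega))]; exact h5
  have h6' : ∀ j ∈ Finset.Icc 2 (n + 1), 0 < r j ∧ r j < 1 + r 0 - r (j + 1) := fun j hj => by
    have hj2 := (Finset.mem_Icc.1 hj).1
    rw [hrj j (by omega), hrj (j + 1) (by omega), hr0]; exact h6 j hj
  have h12' : r 1 + r 2 < 1 + r 0 := by rw [hrj 1 (by omega), hrj 2 (by omega), hr0]; exact h12
  obtain ⟨hE, hA, hAodd⟩ := corner_of_vwp (k := n) r h5' h6' h12'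
  have hsum : ∀ s : Finset ℕ, ∑ m ∈ s, ((1 + r 0 - r (2 * m + 3)) - r (2 * m + 2)) =
      ∑ m ∈ s, ((1 + v - h (2 * m + 3)).re - (h (2 * m + 2)).re) := fun s =>
    Finset.sum_congr rfl fun m _ => by rw [hrj (2 * m + 3) (by omega), hrj (2 * m + 2) (by omega), hr0]; simp
  have hdiff := differentiableAt_shift hn (h 1) h1 (fun j => h (j + 2)) (fun j => h (j + 3)) v
    (fun j hj => by
      have hEj := hE j hj
      rw [hrj (j + 2) (by omega), hrj (j + 3) (by omega), hr0] at hEj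
      simpa using hEj)
    (fun i hi => by
      have hAi := hA i hi
      rw [hrj 1 (by omega), hrj (2 * i + 1 + 2) (by omega), hsum] at hAi
      simpa [add_assoc] using hAi)
    (fun hodd => by
      have hAo := hAodd hodd
      rw [hrj 1 (by omega), hsum] at hAo
      simpa using hAo)
  simpa using hdiff

/-- **The F-side**: `v ↦ P_n(h_v)·F_{n+2}(h_v)` (typed shapes, `h_v = Function.update h 0 v`) is holomorphic at every `v` with `Re v > 0`,
`Re h_i < 1 + Re v` (`i ∈ Icc 1 (n+2)`), `Re h₁ + Re h₂ < 1 + Re v`, `Re h_j + Re h_{j+1} < 1 + Re v` (`j ∈ Icc 2 (n+1)`) and (5). -/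
theorem differentiableAt_lhs (n : ℕ) (h : ℕ → ℂ) (v : ℂ) (hv : 0 < v.re) (hpos : ∀ i ∈ Finset.Icc 1 (n + 2), 0 < (h i).re)
    (hden : ∀ i ∈ Finset.Icc 1 (n + 2), (h i).re < 1 + v.re)
    (hpair : ∀ j ∈ Finset.Icc 1 (n + 1), (h j).re + (h (j + 1)).re < 1 + v.re)
    (h5 : 2 * (∑ i ∈ Finset.Icc 1 (n + 2), (h i).re) < ((n : ℝ) + 1) * (1 + v.re)) :
    DifferentiableAt ℂ (fun w : ℂ =>
      (∏ i ∈ Finset.Icc 1 (n + 1), Complex.Gamma (1 + Function.update h 0 w 0 - Function.update h 0 w i - Function.update h 0 w (i + 1))) /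
          (Complex.Gamma (Function.update h 0 w 1) * Complex.Gamma (Function.update h 0 w (n + 2))) *
        (∑' μ : ℕ, (Function.update h 0 w 0 + 2 * (μ : ℂ)) *
          (∏ i ∈ Finset.range (n + 3), Complex.Gamma (Function.update h 0 w i + μ) /
            Complex.Gamma (1 + Function.update h 0 w 0 - Function.update h 0 w i + μ)) * (-1 : ℂ) ^ ((n + 3) * μ))) v := by
  -- rewrite the function without `Function.update`
  have hfun : (fun w : ℂ =>
      (∏ i ∈ Finset.Icc 1 (n + 1), Complex.Gamma (1 + Function.update h 0 w 0 - Function.update h 0 w i - Function.update h 0 w (i + 1))) /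
          (Complex.Gamma (Function.update h 0 w 1) * Complex.Gamma (Function.update h 0 w (n + 2))) *
        (∑' μ : ℕ, (Function.update h 0 w 0 + 2 * (μ : ℂ)) *
          (∏ i ∈ Finset.range (n + 3), Complex.Gamma (Function.update h 0 w i + μ) /
            Complex.Gamma (1 + Function.update h 0 w 0 - Function.update h 0 w i + μ)) * (-1 : ℂ) ^ ((n + 3) * μ))) =
      fun w : ℂ => (∏ i ∈ Finset.Icc 1 (n + 1), Complex.Gamma (1 + w - h i - h (i + 1))) / (Complex.Gamma (h 1) * Complex.Gamma (h (n + 2))) *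
        (∑' μ : ℕ, (w + 2 * (μ : ℂ)) * (Complex.Gamma (w + μ) / Complex.Gamma (1 + μ) *
          ∏ i ∈ Finset.Icc 1 (n + 2), Complex.Gamma (h i + μ) / Complex.Gamma (1 + w - h i + μ)) * (-1 : ℂ) ^ ((n + 2 + 1) * μ)) := by
    funext w
    have ht : ∀ μ : ℕ, (Function.update h 0 w 0 + 2 * (μ : ℂ)) *
          (∏ i ∈ Finset.range (n + 3), Complex.Gamma (Function.update h 0 w i + μ) /
            Complex.Gamma (1 + Function.update h 0 w 0 - Function.update h 0 w i + μ)) * (-1 : ℂ) ^ ((n + 3) * μ) =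
        (w + 2 * (μ : ℂ)) * (Complex.Gamma (w + μ) / Complex.Gamma (1 + μ) *
          ∏ i ∈ Finset.Icc 1 (n + 2), Complex.Gamma (h i + μ) / Complex.Gamma (1 + w - h i + μ)) * (-1 : ℂ) ^ ((n + 2 + 1) * μ) := by
      intro μ
      rw [show n + 3 = n + 2 + 1 by ring, prod_update_zero (n + 2) h w μ, Function.update_self]
    simp_rw [ht]
    have hne : ∀ i ∈ Finset.Icc 1 (n + 1), Function.update h 0 w i = h i ∧ Function.update h 0 w (i + 1) = h (i + 1) := fun i hi => by
      have := (Finset.mem_Icc.1 hi).1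
      exact ⟨Function.update_of_ne (by omega) _ _, Function.update_of_ne (by omega) _ _⟩
    rw [Finset.prod_congr rfl (fun i hi => by rw [(hne i hi).1, (hne i hi).2]), Function.update_of_ne (by omega : (1 : ℕ) ≠ 0),
      Function.update_of_ne (by omega : n + 2 ≠ 0), Function.update_self]
  rw [hfun]
  refine DifferentiableAt.mul (DifferentiableAt.div_const ?_ _) ?_
  · refine DifferentiableAt.fun_finsetProd (f := fun i w => Complex.Gamma (1 + w - h i - h (i + 1))) fun i hi => ?_
    exact (Complex.differentiableAt_Gamma _ (ne_neg_nat_of_re_pos (by simp; linarith [hpair i hi]))).comp v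
      ((((differentiableAt_const _).add differentiableAt_id).sub_const _).sub_const _)
  · have := differentiableAt_series_h0 (n + 2) h (fun i hi => hpos i hi) hv (fun i hi => hden i hi)
      (by push_cast; linarith)
    exact this

/-! ### 4. The continuation -/

/-- **Continuation in `h₀`** [VWP-BLUEPRINT-g28 §3 (g)]: fix `n ≥ 1` and complex `h₁, …, h_{n+2}` with `Re h₁ > 0`, `Re h_i > 0`; let `M ≥ 0`
dominate the lower bounds on `h₀` of the typed hypotheses (`Re h₁+Re h₂−1 ≤ M`, `Re h_j+Re h_{j+1}−1 ≤ M` for `j ∈ Icc 2 (n+1)`,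
`(2/(n+1))Σ Re h_j − 1 ≤ M`).  If `S(n)(h_t)` holds for every REAL `t > L'` with `M ≤ L'`, then `S(n)(h_v)` holds for every complex
`v` with `Re v > M` (`h_v = Function.update h 0 v`). -/
theorem continuation {n : ℕ} (hn : 1 ≤ n) (h : ℕ → ℂ) (hpos : ∀ i ∈ Finset.Icc 1 (n + 2), 0 < (h i).re) {M L' : ℝ} (hM0 : 0 ≤ M)
    (hM12 : (h 1).re + (h 2).re - 1 ≤ M) (hM6 : ∀ j ∈ Finset.Icc 2 (n + 1), (h j).re + (h (j + 1)).re - 1 ≤ M)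
    (hM5 : (2 / ((n : ℝ) + 1)) * (∑ j ∈ Finset.Icc 1 (n + 2), (h j).re) - 1 ≤ M) (hML : M ≤ L')
    (hreal : ∀ t : ℝ, L' < t →
      (∏ i ∈ Finset.Icc 1 (n + 1), Complex.Gamma (1 + Function.update h 0 (t : ℂ) 0 - Function.update h 0 (t : ℂ) i -
            Function.update h 0 (t : ℂ) (i + 1))) /
          (Complex.Gamma (Function.update h 0 (t : ℂ) 1) * Complex.Gamma (Function.update h 0 (t : ℂ) (n + 2))) *
        (∑' μ : ℕ, (Function.update h 0 (t : ℂ) 0 + 2 * (μ : ℂ)) *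
          (∏ i ∈ Finset.range (n + 3), Complex.Gamma (Function.update h 0 (t : ℂ) i + μ) /
            Complex.Gamma (1 + Function.update h 0 (t : ℂ) 0 - Function.update h 0 (t : ℂ) i + μ)) * (-1 : ℂ) ^ ((n + 3) * μ)) =
      ∫ x in Set.pi univ (fun _ : Fin n => Icc (0 : ℝ) 1),
        (∏ j : Fin n, ((x j : ℝ) : ℂ) ^ (Function.update h 0 (t : ℂ) (j + 2) - 1) *
            (1 - ((x j : ℝ) : ℂ)) ^ ((1 + Function.update h 0 (t : ℂ) 0 - Function.update h 0 (t : ℂ) (j + 3)) -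
              Function.update h 0 (t : ℂ) (j + 2) - 1)) *
          ((nestedQ (List.ofFn x) : ℝ) : ℂ) ^ (-Function.update h 0 (t : ℂ) 1))
    {v : ℂ} (hv : M < v.re) :
    (∏ i ∈ Finset.Icc 1 (n + 1), Complex.Gamma (1 + Function.update h 0 v 0 - Function.update h 0 v i - Function.update h 0 v (i + 1))) /
          (Complex.Gamma (Function.update h 0 v 1) * Complex.Gamma (Function.update h 0 v (n + 2))) *
        (∑' μ : ℕ, (Function.update h 0 v 0 + 2 * (μ : ℂ)) *
          (∏ i ∈ Finset.range (n + 3), Complex.Gamma (Function.update h 0 v i + μ) /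
            Complex.Gamma (1 + Function.update h 0 v 0 - Function.update h 0 v i + μ)) * (-1 : ℂ) ^ ((n + 3) * μ)) =
      ∫ x in Set.pi univ (fun _ : Fin n => Icc (0 : ℝ) 1),
        (∏ j : Fin n, ((x j : ℝ) : ℂ) ^ (Function.update h 0 v (j + 2) - 1) *
            (1 - ((x j : ℝ) : ℂ)) ^ ((1 + Function.update h 0 v 0 - Function.update h 0 v (j + 3)) - Function.update h 0 v (j + 2) - 1)) *
          ((nestedQ (List.ofFn x) : ℝ) : ℂ) ^ (-Function.update h 0 v 1) := by
  set U : Set ℂ := {w : ℂ | M < w.re} with hU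
  have hUo : IsOpen U := isOpen_lt continuous_const Complex.continuous_re
  have hUc : IsPreconnected U := (convex_halfSpace_re_gt M).isPreconnected
  -- the J-side written without `Function.update`
  have hJfun : ∀ w : ℂ, (∫ x in Set.pi univ (fun _ : Fin n => Icc (0 : ℝ) 1),
        (∏ j : Fin n, ((x j : ℝ) : ℂ) ^ (Function.update h 0 w (j + 2) - 1) *
            (1 - ((x j : ℝ) : ℂ)) ^ ((1 + Function.update h 0 w 0 - Function.update h 0 w (j + 3)) - Function.update h 0 w (j + 2) - 1)) *
          ((nestedQ (List.ofFn x) : ℝ) : ℂ) ^ (-Function.update h 0 w 1)) =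
      ∫ x in Set.pi univ (fun _ : Fin n => Icc (0 : ℝ) 1),
        (∏ j : Fin n, ((x j : ℝ) : ℂ) ^ (h (j + 2) - 1) * (1 - ((x j : ℝ) : ℂ)) ^ ((1 + w - h (j + 3)) - h (j + 2) - 1)) *
          ((nestedQ (List.ofFn x) : ℝ) : ℂ) ^ (-h 1) := by
    intro w
    simp only [Function.update_self, Function.update_of_ne (Nat.succ_ne_zero _)]
  -- typed hypotheses at every point of `U`
  have hsum0 : 0 ≤ ∑ j ∈ Finset.Icc 1 (n + 2), (h j).re := Finset.sum_nonneg fun j hj => (hpos j hj).le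
  have hyp : ∀ w ∈ U, 0 < w.re ∧ (h 1).re + (h 2).re < 1 + w.re ∧
      (∀ j ∈ Finset.Icc 2 (n + 1), 0 < (h j).re ∧ (h j).re < 1 + w.re - (h (j + 1)).re) ∧
      (2 / ((n : ℝ) + 1)) * (∑ j ∈ Finset.Icc 1 (n + 2), (h j).re) < 1 + w.re := by
    intro w hw
    have hw' : M < w.re := hw
    refine ⟨by linarith, by linarith, fun j hj => ⟨hpos j (Finset.mem_Icc.2 ⟨by have := (Finset.mem_Icc.1 hj).1; omega,
      by have := (Finset.mem_Icc.1 hj).2; omega⟩), by linarith [hM6 j hj]⟩, by linarith⟩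
  have hg : DifferentiableOn ℂ (fun w : ℂ => ∫ x in Set.pi univ (fun _ : Fin n => Icc (0 : ℝ) 1),
      (∏ j : Fin n, ((x j : ℝ) : ℂ) ^ (h (j + 2) - 1) * (1 - ((x j : ℝ) : ℂ)) ^ ((1 + w - h (j + 3)) - h (j + 2) - 1)) *
        ((nestedQ (List.ofFn x) : ℝ) : ℂ) ^ (-h 1)) U := fun w hw => by
    obtain ⟨hw0, hw12, hw6, hw5⟩ := hyp w hw
    exact (differentiableAt_rhs hn h w (hpos 1 (by simp)).le hw5 hw6 hw12).differentiableWithinAt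
  have hf : DifferentiableOn ℂ (fun w : ℂ =>
      (∏ i ∈ Finset.Icc 1 (n + 1), Complex.Gamma (1 + Function.update h 0 w 0 - Function.update h 0 w i - Function.update h 0 w (i + 1))) /
          (Complex.Gamma (Function.update h 0 w 1) * Complex.Gamma (Function.update h 0 w (n + 2))) *
        (∑' μ : ℕ, (Function.update h 0 w 0 + 2 * (μ : ℂ)) *
          (∏ i ∈ Finset.range (n + 3), Complex.Gamma (Function.update h 0 w i + μ) /
            Complex.Gamma (1 + Function.update h 0 w 0 - Function.update h 0 w i + μ)) * (-1 : ℂ) ^ ((n + 3) * μ))) U := fun w hw => by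
    obtain ⟨hw0, hw12, hw6, hw5⟩ := hyp w hw
    have hpair : ∀ j ∈ Finset.Icc 1 (n + 1), (h j).re + (h (j + 1)).re < 1 + w.re := by
      intro j hj
      rcases Nat.lt_or_ge j 2 with hj2 | hj2
      · have : j = 1 := by have := (Finset.mem_Icc.1 hj).1; omega
        subst this; exact hw12
      · have := hw6 j (Finset.mem_Icc.2 ⟨hj2, (Finset.mem_Icc.1 hj).2⟩); linarith
    have hden : ∀ i ∈ Finset.Icc 1 (n + 2), (h i).re < 1 + w.re := by
      intro i hi
      have hi1 := (Finset.mem_Icc.1 hi).1; have hi2 := (Finset.mem_Icc.1 hi).2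
      rcases Nat.lt_or_ge i (n + 2) with hlt | hge
      · have := hpair i (Finset.mem_Icc.2 ⟨hi1, by omega⟩); linarith [hpos (i + 1) (Finset.mem_Icc.2 ⟨by omega, by omega⟩)]
      · have : i = n + 2 := by omega
        subst this
        have := hpair (n + 1) (Finset.mem_Icc.2 ⟨by omega, le_rfl⟩); linarith [hpos (n + 1) (Finset.mem_Icc.2 ⟨by omega, by omega⟩)]
    have h5' : 2 * (∑ i ∈ Finset.Icc 1 (n + 2), (h i).re) < ((n : ℝ) + 1) * (1 + w.re) := by
      have hn0 : (0 : ℝ) < (n : ℝ) + 1 := by positivity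
      rw [div_mul_eq_mul_div, div_lt_iff₀ hn0] at hw5; linarith
    exact (differentiableAt_lhs n h w hw0 hpos hden hpair h5').differentiableWithinAt
  -- apply the identity theorem at `x₀ = L' + 1`
  have hx₀ : ((L' + 1 : ℝ) : ℂ) ∈ U := by simp only [hU, Set.mem_setOf_eq, Complex.ofReal_re]; linarith
  have hev : ∀ᶠ t : ℝ in 𝓝 (L' + 1), (fun w : ℂ =>
      (∏ i ∈ Finset.Icc 1 (n + 1), Complex.Gamma (1 + Function.update h 0 w 0 - Function.update h 0 w i - Function.update h 0 w (i + 1))) /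
          (Complex.Gamma (Function.update h 0 w 1) * Complex.Gamma (Function.update h 0 w (n + 2))) *
        (∑' μ : ℕ, (Function.update h 0 w 0 + 2 * (μ : ℂ)) *
          (∏ i ∈ Finset.range (n + 3), Complex.Gamma (Function.update h 0 w i + μ) /
            Complex.Gamma (1 + Function.update h 0 w 0 - Function.update h 0 w i + μ)) * (-1 : ℂ) ^ ((n + 3) * μ))) t =
      (fun w : ℂ => ∫ x in Set.pi univ (fun _ : Fin n => Icc (0 : ℝ) 1),
        (∏ j : Fin n, ((x j : ℝ) : ℂ) ^ (h (j + 2) - 1) * (1 - ((x j : ℝ) : ℂ)) ^ ((1 + w - h (j + 3)) - h (j + 2) - 1)) *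
          ((nestedQ (List.ofFn x) : ℝ) : ℂ) ^ (-h 1)) t := by
    filter_upwards [Ioi_mem_nhds (by linarith : L' < L' + 1)] with t ht
    rw [hreal t ht, hJfun]
  have hEq := eqOn_of_eventually_eq_ofReal hUo hUc hx₀ hf hg hev hv
  rw [hJfun v]
  simpa using hEq

end Summit.KontsevichZagierPeriods.Zeta5Search.VWPContinuationH0

end
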